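import Mathlib.Analysis.InnerProductSpace.Basic
import HarnessLib

/-!
# Geometric decay of the powers of a symmetric operator with a gap on the orthocomplement
# of an eigenvector (`RCLike` scalars) — PROVED

Topic `Literature/Analysis/OperatorTheory`; the `RCLike 𝕜` (real OR complex scalars) port of
`norm_pow_apply_sub_le_of_gap` of `PositivityImprovingSpectralGap.lean` (which is stated for real
Hilbert spaces and `IsSelfAdjoint`). Setting: an inner product space `E` over `𝕜 = ℝ` or `ℂ`
(completeness is NOT needed), a bounded operator `A : E →L[𝕜] E` symmetric in the elementary
sense `⟪A x, y⟫ = ⟪x, A y⟫` (i.e. `(A : E →ₗ[𝕜] E).IsSymmetric` unfolded; from `IsSelfAdjoint A`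
on a Hilbert space take `hA.isSymmetric`), a unit vector `φ` with `A φ = λ₀ φ`, a number
`θ ≥ 0`, and the bound `‖A w‖ ≤ θ ‖w‖` on `φ^⊥ = {w | ⟪φ, w⟫ = 0}`. Conclusion (**main**,
`norm_pow_apply_sub_le_of_gap_rclike`):

  `‖Aⁿ g - (λ₀ⁿ ⟪φ, g⟫) φ‖ ≤ θⁿ ‖g‖`   for all `n : ℕ`, `g : E`,

i.e. `Aⁿ` is `λ₀ⁿ` times the rank-one projection onto `φ` up to an error of operator norm `≤ θⁿ`
— for a transfer matrix with top eigenvector `φ`, top eigenvalue `λ₀` and second level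
`θ = λ₁ < λ₀` this is exponential clustering at the rate of the gap. Steps, all elementary:

* `inner_sub_inner_smul_eq_zero_and_norm_le_rclike` — `g = ⟪φ, g⟫ φ + w` with `w ⊥ φ` and
  `‖w‖ ≤ ‖g‖` (Pythagoras);
* `inner_apply_eq_zero_of_inner_eq_zero_rclike` — `φ^⊥` is `A`-invariant:
  `⟪φ, A w⟫ = ⟪A φ, w⟫ = conj λ₀ · ⟪φ, w⟫ = 0` (conjugate-linearity in the first slot);
* `inner_pow_apply_eq_zero_and_norm_pow_apply_le` — by induction, `Aᵏ w ⊥ φ` and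
  `‖Aᵏ w‖ ≤ θᵏ ‖w‖` for `w ⊥ φ`;
* `pow_apply_eq_pow_smul_of_apply_eq_smul_rclike` — `Aᵏ φ = λ₀ᵏ φ`;
* `norm_pow_apply_sub_le_of_gap_rclike` (**main**) — `Aⁿ g - (λ₀ⁿ ⟪φ, g⟫) φ = Aⁿ w`;
* `norm_inner_pow_apply_sub_le_of_gap_rclike` — the matrix-element form
  `‖⟪x, Aⁿ g⟫ - λ₀ⁿ ⟪φ, g⟫ ⟪x, φ⟫‖ ≤ θⁿ ‖x‖ ‖g‖` (Cauchy–Schwarz).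

Sources: the standard "spectral gap ⟹ exponential clustering" bookkeeping of the transfer-matrix
formalism (Glimm–Jaffe, *Quantum Physics*, 2nd ed. 1987, §6.1; Reed–Simon IV, §XIII.12) —
folklore linear algebra with no single printed source. Tree search
(`'norm_pow_apply_sub_le|norm_inner_pow_apply_sub_le|gapNorm'`): the real-scalar
`norm_pow_apply_sub_le_of_gap` (`PositivityImprovingSpectralGap.lean`: `InnerProductSpace ℝ`,
`CompleteSpace`, `IsSelfAdjoint`) and
`Literature.Probability.LatticeModels.TransferData.norm_inner_pow_apply_sub_le` (complex Hilbert
space, eigenvalue `1`, the gap packaged as `gapNorm = ‖T ∘ P_{Ω^⊥}‖`, uses the orthogonal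
projection hence completeness); neither covers a general `RCLike` pre-Hilbert space with a general
top eigenvalue `λ₀ : 𝕜`, which is what the compact-transfer-operator route to clustering of
lattice correlators consumes. Mathlib has the ingredients (`inner_smul_left/right`,
`norm_add_sq_eq_norm_sq_add_norm_sq_of_inner_eq_zero`, `norm_inner_le_norm`,
`mul_apply_eq_comp`) but no such statement. What is NOT here: the existence of `φ`, `λ₀`, `θ`
(inputs; see `CompactPositiveTopLevel.lean` and `SecondLevelGapDense.lean` in this directory).
-/

namespace Literature.Analysis.OperatorTheory

open scoped InnerProductSpace

section GapDecay

variable {𝕜 : Type*} [RCLike 𝕜] {E : Type*} [NormedAddCommGroup E] [InnerProductSpace 𝕜 E]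

/-- **Orthogonal decomposition along a unit vector.** For `‖φ‖ = 1` the vector
`w = g - ⟪φ, g⟫ φ` satisfies `⟪φ, w⟫ = 0` and `‖w‖ ≤ ‖g‖` (Pythagoras:
`‖g‖² = ‖⟪φ, g⟫ φ‖² + ‖w‖²`); `RCLike` version of the real-scalar
`inner_sub_inner_smul_eq_zero_and_norm_le`. [folklore] -/
theorem inner_sub_inner_smul_eq_zero_and_norm_le_rclike {φ : E} (hφ : ‖φ‖ = 1) (g : E) :
    ⟪φ, g - ⟪φ, g⟫_𝕜 • φ⟫_𝕜 = 0 ∧ ‖g - ⟪φ, g⟫_𝕜 • φ‖ ≤ ‖g‖ := by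
  have hφφ : ⟪φ, φ⟫_𝕜 = 1 := inner_self_eq_one_of_norm_eq_one hφ
  have hwo : ⟪φ, g - ⟪φ, g⟫_𝕜 • φ⟫_𝕜 = 0 := by
    rw [inner_sub_right, inner_smul_right, hφφ, mul_one, sub_self]
  refine ⟨hwo, ?_⟩
  have horth : ⟪⟪φ, g⟫_𝕜 • φ, g - ⟪φ, g⟫_𝕜 • φ⟫_𝕜 = 0 := by
    rw [inner_smul_left, hwo, mul_zero]
  have h1 := norm_add_sq_eq_norm_sq_add_norm_sq_of_inner_eq_zero _ _ horth
  rw [add_sub_cancel] at h1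
  nlinarith [norm_nonneg (⟪φ, g⟫_𝕜 • φ), norm_nonneg (g - ⟪φ, g⟫_𝕜 • φ), norm_nonneg g]

variable {A : E →L[𝕜] E} {φ : E} {lam₀ : 𝕜} {θ : ℝ}

/-- **`φ^⊥` is invariant under a symmetric operator with `A φ = λ₀ φ`.** If
`⟪A x, y⟫ = ⟪x, A y⟫` for all `x y`, `A φ = λ₀ φ` and `⟪φ, w⟫ = 0`, then
`⟪φ, A w⟫ = ⟪A φ, w⟫ = conj λ₀ · ⟪φ, w⟫ = 0`. [folklore] -/
theorem inner_apply_eq_zero_of_inner_eq_zero_rclike (hA : ∀ x y : E, ⟪A x, y⟫_𝕜 = ⟪x, A y⟫_𝕜)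
    (hAφ : A φ = lam₀ • φ) {w : E} (hw : ⟪φ, w⟫_𝕜 = 0) : ⟪φ, A w⟫_𝕜 = 0 := by
  rw [← hA, hAφ, inner_smul_left, hw, mul_zero]

/-- **Powers of `A` on the orthocomplement `φ^⊥`.** If `A` is symmetric, `A φ = λ₀ φ`, `0 ≤ θ` and
`‖A w‖ ≤ θ ‖w‖` for all `w ⊥ φ`, then for every `k` and every `w ⊥ φ` the vector `Aᵏ w` is
again `⊥ φ` and `‖Aᵏ w‖ ≤ θᵏ ‖w‖` (induction on `k` through the invariance of `φ^⊥`).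
[folklore] -/
theorem inner_pow_apply_eq_zero_and_norm_pow_apply_le
    (hA : ∀ x y : E, ⟪A x, y⟫_𝕜 = ⟪x, A y⟫_𝕜) (hAφ : A φ = lam₀ • φ) (hθ : 0 ≤ θ)
    (hgap : ∀ w : E, ⟪φ, w⟫_𝕜 = 0 → ‖A w‖ ≤ θ * ‖w‖) (k : ℕ) {w : E} (hw : ⟪φ, w⟫_𝕜 = 0) :
    ⟪φ, (A ^ k) w⟫_𝕜 = 0 ∧ ‖(A ^ k) w‖ ≤ θ ^ k * ‖w‖ := by
  induction k with
  | zero => simp [hw]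
  | succ k ih =>
    obtain ⟨h1, h2⟩ := ih
    rw [pow_succ', mul_apply_eq_comp]
    refine ⟨inner_apply_eq_zero_of_inner_eq_zero_rclike hA hAφ h1, ?_⟩
    calc ‖A ((A ^ k) w)‖ ≤ θ * ‖(A ^ k) w‖ := hgap _ h1
      _ ≤ θ * (θ ^ k * ‖w‖) := by gcongr
      _ = θ ^ (k + 1) * ‖w‖ := by rw [pow_succ']; ring

/-- **Powers of `A` on the eigenvector**: `A φ = λ₀ φ` gives `Aᵏ φ = λ₀ᵏ φ` (general-scalar
twin of the real `L²` lemma `pow_apply_eq_pow_smul_of_apply_eq_smul` of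
`CyclicKernelSpectralBound.lean`). [folklore] -/
theorem pow_apply_eq_pow_smul_of_apply_eq_smul_rclike (hAφ : A φ = lam₀ • φ) (k : ℕ) :
    (A ^ k) φ = lam₀ ^ k • φ := by
  induction k with
  | zero => simp
  | succ k ih =>
    rw [pow_succ', mul_apply_eq_comp, ih, map_smul, hAφ, smul_smul, ← pow_succ]

/-- **Geometric convergence of the powers from a gap on the orthogonal complement (`RCLike`
scalars).** Let `E` be an inner product space over `𝕜 = ℝ` or `ℂ`, `A : E →L[𝕜] E` symmetric
(`⟪A x, y⟫ = ⟪x, A y⟫`), `φ` a unit vector with `A φ = λ₀ φ`, `θ ≥ 0`, and suppose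
`‖A w‖ ≤ θ ‖w‖` for every `w` with `⟪φ, w⟫ = 0`. Then for every `n` and `g`,
`‖Aⁿ g - (λ₀ⁿ ⟪φ, g⟫) φ‖ ≤ θⁿ ‖g‖`: write `g = ⟪φ, g⟫ φ + w` with `w ⊥ φ`, `‖w‖ ≤ ‖g‖`; then
`Aⁿ g - λ₀ⁿ ⟪φ, g⟫ φ = Aⁿ w` and `‖Aⁿ w‖ ≤ θⁿ ‖w‖` because `φ^⊥` is invariant. (Transfer-matrix
reading: exponential clustering at the rate of the spectral gap; Glimm–Jaffe §6.1.) [folklore] -/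
theorem norm_pow_apply_sub_le_of_gap_rclike : ∀ {𝕜 : Type*} [RCLike 𝕜] {E : Type*}
    [NormedAddCommGroup E] [InnerProductSpace 𝕜 E] (A : E →L[𝕜] E),
    (∀ x y : E, ⟪A x, y⟫_𝕜 = ⟪x, A y⟫_𝕜) → ∀ (φ : E), ‖φ‖ = 1 → ∀ (lam₀ : 𝕜), A φ = lam₀ • φ →
    ∀ (θ : ℝ), 0 ≤ θ → (∀ w : E, ⟪φ, w⟫_𝕜 = 0 → ‖A w‖ ≤ θ * ‖w‖) →
    ∀ (n : ℕ) (g : E), ‖(A ^ n) g - (lam₀ ^ n * ⟪φ, g⟫_𝕜) • φ‖ ≤ θ ^ n * ‖g‖ := by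
  intro 𝕜 _ E _ _ A hA φ hφ lam₀ hAφ θ hθ hgap n g
  obtain ⟨hwo, hwn⟩ := inner_sub_inner_smul_eq_zero_and_norm_le_rclike (𝕜 := 𝕜) hφ g
  have hAg : (A ^ n) g = (lam₀ ^ n * ⟪φ, g⟫_𝕜) • φ + (A ^ n) (g - ⟪φ, g⟫_𝕜 • φ) := by
    rw [map_sub, map_smul, pow_apply_eq_pow_smul_of_apply_eq_smul_rclike hAφ, smul_smul,
      mul_comm ⟪φ, g⟫_𝕜, add_sub_cancel]
  rw [hAg, add_sub_cancel_left]
  calc ‖(A ^ n) (g - ⟪φ, g⟫_𝕜 • φ)‖ ≤ θ ^ n * ‖g - ⟪φ, g⟫_𝕜 • φ‖ :=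
      (inner_pow_apply_eq_zero_and_norm_pow_apply_le hA hAφ hθ hgap n hwo).2
    _ ≤ θ ^ n * ‖g‖ := by gcongr

/-- **Matrix-element form of the geometric decay (exponential clustering of correlations).** Under
the hypotheses of `norm_pow_apply_sub_le_of_gap_rclike` — `A` symmetric, `‖φ‖ = 1`,
`A φ = λ₀ φ`, `θ ≥ 0`, `‖A w‖ ≤ θ ‖w‖` on `φ^⊥` — for all `n` and `x g : E`,
`‖⟪x, Aⁿ g⟫ - λ₀ⁿ ⟪φ, g⟫ ⟪x, φ⟫‖ ≤ θⁿ ‖x‖ ‖g‖`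
(`⟪x, Aⁿ g⟫ - λ₀ⁿ ⟪φ, g⟫ ⟪x, φ⟫ = ⟪x, Aⁿ g - (λ₀ⁿ ⟪φ, g⟫) φ⟫` and Cauchy–Schwarz). [folklore] -/
theorem norm_inner_pow_apply_sub_le_of_gap_rclike (A : E →L[𝕜] E)
    (hA : ∀ x y : E, ⟪A x, y⟫_𝕜 = ⟪x, A y⟫_𝕜) (φ : E) (hφ : ‖φ‖ = 1) (lam₀ : 𝕜)
    (hAφ : A φ = lam₀ • φ) (θ : ℝ) (hθ : 0 ≤ θ)
    (hgap : ∀ w : E, ⟪φ, w⟫_𝕜 = 0 → ‖A w‖ ≤ θ * ‖w‖) (n : ℕ) (x g : E) :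
    ‖⟪x, (A ^ n) g⟫_𝕜 - lam₀ ^ n * ⟪φ, g⟫_𝕜 * ⟪x, φ⟫_𝕜‖ ≤ θ ^ n * ‖x‖ * ‖g‖ := by
  have hkey : ⟪x, (A ^ n) g⟫_𝕜 - lam₀ ^ n * ⟪φ, g⟫_𝕜 * ⟪x, φ⟫_𝕜 =
      ⟪x, (A ^ n) g - (lam₀ ^ n * ⟪φ, g⟫_𝕜) • φ⟫_𝕜 := by
    rw [inner_sub_right, inner_smul_right]
  rw [hkey]
  calc ‖⟪x, (A ^ n) g - (lam₀ ^ n * ⟪φ, g⟫_𝕜) • φ⟫_𝕜‖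
      ≤ ‖x‖ * ‖(A ^ n) g - (lam₀ ^ n * ⟪φ, g⟫_𝕜) • φ‖ := norm_inner_le_norm _ _
    _ ≤ ‖x‖ * (θ ^ n * ‖g‖) := by
        gcongr
        exact norm_pow_apply_sub_le_of_gap_rclike A hA φ hφ lam₀ hAφ θ hθ hgap n g
    _ = θ ^ n * ‖x‖ * ‖g‖ := by ring

end GapDecay

end Literature.Analysis.OperatorTheory
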